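import Summits.ResolutionOfSingularities.ResolutionOfSingularities.Theorems.EquisingularLiftEquisingularLiftNatConeChart
import Literature.AlgebraicGeometry.Resolution.PointBlowupOrderChart
import Literature.AlgebraicGeometry.Resolution.BlowupAlgebraStrictTransform
import Literature.AlgebraicGeometry.Resolution.AdicCompletionRegular
import HarnessLib

/-!
# [OURS · L1 W4.2] D14 ROUTE H, object **H4 — THE EMBEDDED LOCAL STEP**, part 1/2 (ring level): the chart `R[𝔪/c_j]` of
# the blow-up of a regular local ring at its closed point and the strict transform of a hypersurface `V(h)` on it
# (crux chain w42, line `w_ladder` v7, row `stub_Wtop3M_pointed`, kernel K1 `IsoFreeRationalTailsImpossible`;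
# `--supports stmt-ResolutionOfSingularities-19249`, helper)

OURS (cell `res-hironaka`, slot ★L-G4 W4.2, hand res-type-071 for res-L1-w42-plan-1 RULINGS v3.14-4 (BH); spec =
res-L1-w42-lead-1's `D14-BRIDGE-CUT.md` sha16 `ca58498c1b3692f5`, ROUTE H row H4 «EMBEDDED LOCAL STEP: `A = R/(h)`, `R` regular
local, point blow-up: for the closed point `x′ ∈ Bl_𝔪(Spec A)` (= point of the tower) there are a chart index `j` and a prime
`𝔴` of `chartRing c j` (`c` an r.s.p. of `R`) with `𝒪_{x′} ≅ (chartRing c j)_𝔴 ⧸ (h′)`, `φ(h) = φ(c_j)^m · h′`,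
`(chartRing c j)_𝔴` regular»). NOT a statement of H. Hironaka's manuscript [Hironaka2017] (under review in the cell, unused
here) nor of [CossartJannsenSaito2020]; AI-written, weaker than expert review. Sorry-free PROOF file: no definitions, no named facts.

MODEL. We work in the IMAGE MODEL `R[𝔪/c_j] ⊆ R[1/c_j]` of the chart ring (tree `blowupAlgebra`, Görtz–Wedhorn (13.19);
elements `r/c_jᴺ`), which is the tree's `chartRing c j = (R[𝔪t])_{(c_j t)}` along `reesChartEquiv` (Stacks 07Z3); the
scheme ↔ chart dictionary in this model is `IsBlowup.exists_blowupAlgebra_stalk_ringEquiv` (`BlowupStalkBlowupAlgebra.lean`),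
used in part 2/2 (`…IsoTailsEmbeddedStepStalk`).

`R` regular local, `c = (c₁,…,c_d)` a regular system of parameters (`(c) = 𝔪`, `d = μ(𝔪)`), `h ∈ 𝔪^m ∖ 𝔪^{m+1}`, any `j`:
* `span_range_append_elim0` (format adapter to `BlowupChartRsop`'s `(c, w)` with `w` empty), `prime_algebraMap_rsop`, `isRegularRing_blowupAlgebra_rsop`, `isRegularLocalRing_localization_rsop`
  — `c` is quasi-regular (Matsumura 16.2), the exceptional generator `t = c_j/1` is a PRIME element of `B = R[𝔪/c_j]`
  (`B/(t) ≅ κ[T_k : k ≠ j]`, Stacks 0BIQ), `B` and its localisations are regular (Liu 8.1.19 (a));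
* `exists_weakTransform` — the initial form `F` of `h` (`F̄ ≠ 0`, CoP1 (10)) gives the WEAK (= strict) transform
  `h′ = F(c/c_j)` with `h/1 = t^m · h′` and `F̄(T_j := 1) ≠ 0` (W4.5b's cone-chart calculus
  `algebraMap_eval_eq_pow_mul_coneTransform`);
* `exists_strictTransform` — packaged: `h/1 = t^m h′`, `t` prime, `t ∤ h′`, `h′` regular modulo `t` and `t` regular modulo `h′`,
  and **`ker (R[𝔪/c_j] → (R/(h))[𝔪̄/c̄_j]) = (h′)`** (GW 13.96 (2): the chart of `Bl_𝔪(Spec R/(h))` is cut out of the chart of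
  `Bl_𝔪(Spec R)` by the strict transform of the equation); `exists_strictTransform_of_surjective` — the same for any
  surjection `σ : R ↠ A` with `ker σ = (h)` (tree `blowupAlgebraMap σ`, surjective, kernel `(h′)`).

## References
* U. Görtz, T. Wedhorn, *Algebraic Geometry I*, 2nd ed. (2020), (13.19) p. 415, Prop. 13.96 (2) p. 416. [GortzWedhorn2020]
* The Stacks Project, Tags 0804, 07Z3, 0BIQ, 052P. [StacksProject]
* V. Cossart, O. Piltant, J. Algebra 320 (2008), proof of Prop. 4.2, (10)–(11). [CossartPiltant2008]
* Q. Liu, *Algebraic Geometry and Arithmetic Curves* (2002), Thm. 8.1.19 (a). [Liu2002]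
* H. Matsumura, *Commutative Ring Theory* (1986), Thm. 16.2 (i), Thm. 19.3. [Matsumura1987]
-/

noncomputable section

-- the mandated cell namespace `Summit.ResolutionOfSingularities.ResolutionOfSingularities.…` re-enters the summit name
set_option linter.dupNamespace false

open CategoryTheory AlgebraicGeometry TopologicalSpace IsLocalRing
open Literature.AlgebraicGeometry.Resolution
open Summit.ResolutionOfSingularities.ResolutionOfSingularities.Cruxes.EquisingularLiftNat.Sections
  (algebraMap_eval_eq_pow_mul_coneTransform mem_span_algebraMap_of_coneTransform_mul_mem
    mem_span_coneTransform_of_algebraMap_mul_mem)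

namespace Summit.ResolutionOfSingularities.ResolutionOfSingularities.Cruxes.SigmaMaxModifications.IdeasL1C5.EmbeddedStep

universe u

/-! ## §1. Ring level: the chart `R[𝔪/c_j]` of the blow-up of a regular local ring at its closed point, and the strict
transform of a hypersurface `V(h)` on it -/

section Ring

variable {R : Type u} [CommRing R] [IsRegularLocalRing R] {d : ℕ}
  (hd : (maximalIdeal R).spanFinrank = d) (c : Fin d → R)
  (hc : Ideal.span (Set.range c) = maximalIdeal R)

include hc in
/-- The regular system of parameters `c` in the `(c, w)`-format of `BlowupChartRsop.lean` with EMPTY `w` (the whole maximal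
ideal is the centre: point blow-up), so that `isQuasiRegular_centre` / `isRegularLocalRing_quot_centre` apply verbatim.
[folklore] -/
theorem span_range_append_elim0 :
    Ideal.span (Set.range (Fin.append c (Fin.elim0 : Fin 0 → R))) = maximalIdeal R := by
  have hsurj : Function.Surjective (Fin.cast (Nat.add_zero d) : Fin (d + 0) → Fin d) :=
    (finCongr (Nat.add_zero d)).surjective
  rw [Fin.append_elim0, hsurj.range_comp]
  exact hc

include hc in
/-- `(c) = 𝔪` is a maximal ideal. [folklore] -/
theorem isMaximal_span_rsop : (Ideal.span (Set.range c)).IsMaximal :=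
  hc ▸ maximalIdeal.isMaximal R

include hc in
/-- `R/(c) = κ` is a domain. [folklore] -/
theorem isDomain_quotient_span_rsop : IsDomain (R ⧸ Ideal.span (Set.range c)) :=
  (Ideal.Quotient.isDomain_iff_prime _).mpr (isMaximal_span_rsop c hc).isPrime

include hc in
/-- `R/(c) = κ` is a regular ring (a field). [folklore] -/
theorem isRegularRing_quotient_span_rsop : IsRegularRing (R ⧸ Ideal.span (Set.range c)) := by
  haveI := isMaximal_span_rsop c hc
  letI : Field (R ⧸ Ideal.span (Set.range c)) := Ideal.Quotient.field _
  haveI : IsRegularLocalRing (R ⧸ Ideal.span (Set.range c)) := inferInstance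
  exact isRegularRing_of_isRegularLocalRing _

include hd hc in
/-- **The exceptional generator `t = c_j/1` is a PRIME element of `R[𝔪/c_j]`**: `R[𝔪/c_j]/(t) ≅ κ[T_k : k ≠ j]` is a domain
(Stacks 0BIQ, tree `blowupAlgebra.isPrime_span_algebraMap`) and `t` is a non-zero-divisor (Stacks 07Z3 (1)), so `t ≠ 0`.
[cite: StacksProject, Tag 0BIQ] -/
theorem prime_algebraMap_rsop (j : Fin d) :
    Prime (algebraMap R (blowupAlgebra (Ideal.span (Set.range c)) (c j)) (c j)) := by
  haveI := isDomain_quotient_span_rsop c hc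
  have hP := blowupAlgebra.isPrime_span_algebraMap c j (isQuasiRegular_centre c Fin.elim0 (span_range_append_elim0 c hc) hd)
  haveI : Nontrivial (blowupAlgebra (Ideal.span (Set.range c)) (c j)) := by
    by_contra h
    rw [not_nontrivial_iff_subsingleton] at h
    exact hP.ne_top (Subsingleton.elim _ _)
  have hne : algebraMap R (blowupAlgebra (Ideal.span (Set.range c)) (c j)) (c j) ≠ 0 :=
    nonZeroDivisors.ne_zero algebraMap_mem_nonZeroDivisors_blowupAlgebra
  exact (Ideal.span_singleton_prime hne).mp hP

include hd hc in
/-- **`R[𝔪/c_j]` is a regular ring** (`R` regular local, `c` quasi-regular, `R/(c)` a field; Liu Thm. 8.1.19 (a) on the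
charts, tree `blowupAlgebra.isRegularRing`). [cite: Liu2002, Thm. 8.1.19 (a)] -/
theorem isRegularRing_blowupAlgebra_rsop (j : Fin d) :
    IsRegularRing (blowupAlgebra (Ideal.span (Set.range c)) (c j)) := by
  haveI := isRegularRing_of_isRegularLocalRing R
  haveI := isRegularRing_quotient_span_rsop c hc
  exact blowupAlgebra.isRegularRing c j (isQuasiRegular_centre c Fin.elim0 (span_range_append_elim0 c hc) hd)

include hd hc in
/-- Hence every localisation of `R[𝔪/c_j]` at a prime is a regular local ring (the local rings of `Bl_𝔪(Spec R)` on the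
chart). [cite: Liu2002, Thm. 8.1.19 (a)] -/
theorem isRegularLocalRing_localization_rsop (j : Fin d)
    (𝔔 : Ideal (blowupAlgebra (Ideal.span (Set.range c)) (c j))) [𝔔.IsPrime] :
    IsRegularLocalRing (Localization.AtPrime 𝔔) := by
  haveI := isRegularRing_blowupAlgebra_rsop hd c hc j
  infer_instance

include hc in
/-- **The weak transform of `h` via its initial form** (CoP1 (10)–(11)): for `h ∈ 𝔪^m ∖ 𝔪^{m+1}` there is a form `F` of degree
`m` in the parameters with `F(c) = h`, non-zero reduction, `F̄(T_j := 1) ≠ 0`, and `h/1 = (c_j/1)^m · F(c/c_j)` in `R[𝔪/c_j]`.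
[cite: CossartPiltant2008, proof of Prop. 4.2, (10)–(11)] -/
theorem exists_weakTransform (j : Fin d) {h : R} {m : ℕ} (hm : h ∈ maximalIdeal R ^ m)
    (hm' : h ∉ maximalIdeal R ^ (m + 1)) :
    ∃ F : MvPolynomial (Fin d) R, F.IsHomogeneous m ∧ MvPolynomial.eval c F = h ∧
      MvPolynomial.map (Ideal.Quotient.mk (Ideal.span (Set.range c))) F ≠ 0 ∧
      MvPolynomial.map (Ideal.Quotient.mk (Ideal.span (Set.range c))) (dehomogenize j F) ≠ 0 ∧
      algebraMap R (blowupAlgebra (Ideal.span (Set.range c)) (c j)) h =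
        algebraMap R (blowupAlgebra (Ideal.span (Set.range c)) (c j)) (c j) ^ m *
          MvPolynomial.aeval (blowupAlgebra.frac c j) F := by
  classical
  obtain ⟨F, hF, hFh, hF0⟩ := exists_isHomogeneous_eval_eq_map_residue_ne_zero c hc hm hm'
  refine ⟨F, hF, hFh, hF0, ?_, ?_⟩
  · rw [map_dehomogenize]
    exact dehomogenize_ne_zero_of_isHomogeneous j (hF.map _) hF0
  · rw [← hFh]
    exact algebraMap_eval_eq_pow_mul_coneTransform c j hF

include hd hc in
/-- **THE STRICT TRANSFORM OF `V(h)` ON THE CHART `R[𝔪/c_j]`.** For `h ∈ 𝔪^m ∖ 𝔪^{m+1}` there is `h′ ∈ R[𝔪/c_j]` with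
`h/1 = t^m · h′` (`t = c_j/1`), `t` prime, `t ∤ h′`, `h′` a non-zero-divisor modulo `t` and `t` a non-zero-divisor modulo `h′`,
and the kernel of the chart map `R[𝔪/c_j] → (R/(h))[𝔪̄/c̄_j]` onto the chart ring of `Bl_𝔪(Spec R/(h))` is `(h′)`.
[cite: GortzWedhorn2020, Prop. 13.96 (2) and p. 416] -/
theorem exists_strictTransform (j : Fin d) {h : R} {m : ℕ} (hm : h ∈ maximalIdeal R ^ m)
    (hm' : h ∉ maximalIdeal R ^ (m + 1)) :
    ∃ h' : blowupAlgebra (Ideal.span (Set.range c)) (c j),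
      algebraMap R _ h = algebraMap R _ (c j) ^ m * h' ∧
      Prime (algebraMap R (blowupAlgebra (Ideal.span (Set.range c)) (c j)) (c j)) ∧
      ¬ algebraMap R (blowupAlgebra (Ideal.span (Set.range c)) (c j)) (c j) ∣ h' ∧
      (∀ y, h' * y ∈ Ideal.span {algebraMap R (blowupAlgebra (Ideal.span (Set.range c)) (c j)) (c j)} →
        y ∈ Ideal.span {algebraMap R (blowupAlgebra (Ideal.span (Set.range c)) (c j)) (c j)}) ∧
      (∀ y, algebraMap R (blowupAlgebra (Ideal.span (Set.range c)) (c j)) (c j) * y ∈ Ideal.span {h'} →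
        y ∈ Ideal.span {h'}) ∧
      RingHom.ker (blowupAlgebra.mapQuotient (Ideal.span (Set.range c)) (c j) (Ideal.span {h})) =
        Ideal.span {h'} := by
  haveI := isDomain_quotient_span_rsop c hc
  have hqr := isQuasiRegular_centre c Fin.elim0 (span_range_append_elim0 c hc) hd
  obtain ⟨F, hF, -, -, hFj, hfac⟩ := exists_weakTransform c hc j hm hm'
  have hprime := prime_algebraMap_rsop hd c hc j
  have hregt : ∀ y, MvPolynomial.aeval (blowupAlgebra.frac c j) F * y ∈
      Ideal.span {algebraMap R (blowupAlgebra (Ideal.span (Set.range c)) (c j)) (c j)} →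
      y ∈ Ideal.span {algebraMap R (blowupAlgebra (Ideal.span (Set.range c)) (c j)) (c j)} :=
    mem_span_algebraMap_of_coneTransform_mul_mem c j hqr hFj
  have hndvd : ¬ algebraMap R (blowupAlgebra (Ideal.span (Set.range c)) (c j)) (c j) ∣
      MvPolynomial.aeval (blowupAlgebra.frac c j) F := by
    intro hdvd
    have h1 : (1 : blowupAlgebra (Ideal.span (Set.range c)) (c j)) ∈
        Ideal.span {algebraMap R (blowupAlgebra (Ideal.span (Set.range c)) (c j)) (c j)} :=
      hregt 1 (by rw [mul_one]; exact Ideal.mem_span_singleton.mpr hdvd)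
    exact hprime.not_unit (isUnit_of_dvd_one (Ideal.mem_span_singleton.mp h1))
  exact ⟨_, hfac, hprime, hndvd, hregt, mem_span_coneTransform_of_algebraMap_mul_mem c j hqr hFj,
    blowupAlgebra.ker_mapQuotient_eq_span _ _ hfac hprime hndvd⟩

include hd hc in
/-- **The same kernel for an abstract surjection `σ : R ↠ A` with `ker σ = (h)`** (so `A ≅ R/(h)`; e.g. `A = 𝒪_{X,x}` a
hypersurface stalk): the surjection `R[𝔪/c_j] ↠ A[𝔪_A/σ(c_j)]` (tree `blowupAlgebraMap`) has kernel `(h′)`.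
[cite: GortzWedhorn2020, Prop. 13.96 (2) and p. 416] -/
theorem exists_strictTransform_of_surjective (j : Fin d) {h : R} {m : ℕ} (hm : h ∈ maximalIdeal R ^ m)
    (hm' : h ∉ maximalIdeal R ^ (m + 1)) {A : Type u} [CommRing A] (σ : R →+* A)
    (hσ : Function.Surjective σ) (hker : RingHom.ker σ = Ideal.span {h})
    (hIJ : (Ideal.span (Set.range c)).map σ ≤ Ideal.span (Set.range fun i => σ (c i))) :
    ∃ h' : blowupAlgebra (Ideal.span (Set.range c)) (c j),
      algebraMap R _ h = algebraMap R _ (c j) ^ m * h' ∧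
      Prime (algebraMap R (blowupAlgebra (Ideal.span (Set.range c)) (c j)) (c j)) ∧
      ¬ algebraMap R (blowupAlgebra (Ideal.span (Set.range c)) (c j)) (c j) ∣ h' ∧
      (∀ y, algebraMap R (blowupAlgebra (Ideal.span (Set.range c)) (c j)) (c j) * y ∈ Ideal.span {h'} →
        y ∈ Ideal.span {h'}) ∧
      Function.Surjective
        (blowupAlgebraMap σ (Ideal.span (Set.range c)) (Ideal.span (Set.range fun i => σ (c i))) (c j) hIJ) ∧
      RingHom.ker (blowupAlgebraMap σ (Ideal.span (Set.range c)) (Ideal.span (Set.range fun i => σ (c i))) (c j) hIJ) =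
        Ideal.span {h'} := by
  obtain ⟨h', hfac, hprime, hndvd, -, hreg, -⟩ := exists_strictTransform hd c hc j hm hm'
  have hJI : Ideal.span (Set.range fun i => σ (c i)) ≤ (Ideal.span (Set.range c)).map σ := by
    rw [Ideal.map_span, ← Set.range_comp]
    exact le_rfl
  exact ⟨h', hfac, hprime, hndvd, hreg, blowupAlgebraMap_surjective σ _ _ (c j) hσ hIJ hJI,
    ker_blowupAlgebraMap_eq_span σ _ hIJ hker hfac hprime hndvd⟩

end Ring

end Summit.ResolutionOfSingularities.ResolutionOfSingularities.Cruxes.SigmaMaxModifications.IdeasL1C5.EmbeddedStep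

end
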